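import Literature.NumberTheory.BeurlingPrimes.WeightedPerron
import Literature.NumberTheory.BeurlingPrimes.BeurlingMoebius
import Literature.NumberTheory.BeurlingPrimes.DeletedPrimesHyperbola
import Literature.NumberTheory.LFunctions.RHLittlewoodZetaBounds
import HarnessLib

/-!
# Perron for the `S`-smooth integers: `N_𝒮(x)`, `N_𝒮(x) + M_𝒮(x) = a_𝒮 x^α + O_ε(x^{α/2+ε})` under RH (BDR 2023, §5)

Topic `Literature/NumberTheory/BeurlingPrimes`. Everything in this file is PROVED (definitions + theorems).

Broucke–Debruyne–Révész [BDR 2023, §5 p. 16]: "Using that `ζ_𝒮(s) = ζ(s+1−α) e^{Z(s)}` where `Z(s)` … has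
analytic continuation to `Re s > α/2` … `Z(s) ≪_ε √log(|t|+2)` …, an application of the Perron formula as
performed in the proof of Theorem 3.2 leads to `N_𝒮(x) := Σ_{n ≤ x, n ∈ 𝒩_𝒮} 1 = a_𝒮 x^α + O_ε(x^{α/2+ε})`, for some
`a_𝒮 > 0` and each `ε > 0`. … the same asymptotic estimate holds for the non-decreasing function
`N_𝒮(x) + M_𝒮(x)`, whose Mellin–Stieltjes transform is `ζ_𝒮(s) + 1/ζ_𝒮(s)`. Here, `M_𝒮(x) := Σ_{n ≤ x, n ∈ 𝒩_𝒮} μ(n)`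
… . If we assume the Riemann hypothesis, then `1/ζ_𝒮(s)` has analytic continuation to `Re s > α/2` which
satisfies the bound `1/ζ_𝒮(s) ≪_ε |t|^ε` there."

This file performs exactly that application of the generic order-one Perron inversion
`wCount_asymptotic` (`WeightedPerron.lean`, poles `{α}`, line `κ = 2`, shifted line `σ₁ = α/2 + ε/2`, `η = ε/2`) to
the Beurling system `𝒫_𝒮 = ratPrimes.restrict (delIdx S)` with the weights `1` and `1 + μ_𝒫` (`BeurlingMoebius.lean`),
GIVEN the factorization `ζ_𝒮(s) = ζ(s+1−α)·E(s)` for `Re s > 1` with `E` holomorphic and zero-free on `Re s > α/2`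
and `‖E^{±1}(s)‖ ≪_η (1+|t|)^η` on `α/2 < σ₁ ≤ Re s ≤ 3` (provided by `DeletedPrimesZeta.lean`), and RH (through the
tree's Littlewood bounds `ζ^{±1}(s) ≪ |t|^ε`, `RHLittlewoodZetaBounds.lean`):
* the dictionary between the Beurling side and `ℕ`: the integers of `𝒫_𝒮` are the `S`-smooth positive integers
  (`isSmooth_encode_iff`, `sum_intFinset_restrict_eq`), `wCount 𝒫_𝒮 1 x = Σ_{n ≤ x} 1_{𝒩_𝒮}(n)` and
  `wCount 𝒫_𝒮 (1 + μ_𝒫) x = Σ_{n ≤ x} (μ_𝒮 + 1_{𝒩_𝒮})(n)` (`wCount_restrict_one`, `wCount_restrict_one_add_moebW`; the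
  Möbius function depends only on the exponent pattern, `moebius_encode_mapDomain`);
* the regular part `regPart α E s = ζ₀(s+1−α)E(s) + dslope E α s` of `ζ(s+1−α)E(s)` at its pole `α`
  (`mul_eq_polePart_add_regPart`) and the continuation `invPart α E s = (s−α)/ζ₁(s+1−α) · E(s)⁻¹` of `1/ζ_𝒮`
  (`ζ₀, ζ₁` Mathlib's entire `riemannZeta₀`, `riemannZeta₁`), their holomorphy and `(1+|t|)^η` growth in the strip;
* **`smooth_partialSum_asymptotics`**: under RH, for `1/2 < α < 1`, both `Σ_{n ≤ u} 1_{𝒩_𝒮}(n)` and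
  `Σ_{n ≤ u} (μ_𝒮 + 1_{𝒩_𝒮})(n)` equal `(Re E(α)/α) u^α + O_ε(u^{α/2+ε})` on `u ≥ 1` — the hypotheses `hN`, `hNM` of
  `freeCount_asymptotic` (`DeletedPrimesHyperbola.lean`).

## References
* [BrouckeDebruyneRevesz2023] F. Broucke, G. Debruyne, Sz. Gy. Révész, *Some examples of well-behaved
  Beurling number systems*, arXiv:2309.01567, §5 p. 16; proof of Theorem 3.2, (3.5)–(3.8) (read:
  `lit read arxiv-2309.01567`, pp. 8–10, 16).
* [Titchmarsh1986] E. C. Titchmarsh, *The theory of the Riemann zeta-function*, 2nd ed., Thm 14.2.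
-/

noncomputable section

open Complex Filter Set ArithmeticFunction
open scoped Topology ArithmeticFunction.Moebius

namespace Literature.NumberTheory.BeurlingPrimes

open Literature.Barriers.RiemannHypothesis Literature.NumberTheory.LFunctions

/-! ### The integers of `𝒫_𝒮` are the `S`-smooth integers -/

section dictionary

variable {S : Set ℕ}

/-- `encode k` is `S`-smooth iff the exponent vector `k` is supported on deleted indices. [folklore] -/
theorem isSmooth_encode_iff (k : ℕ →₀ ℕ) : IsSmooth S (encode k) ↔ (k.support : Set ℕ) ⊆ delIdx S := by
  classical
  unfold IsSmooth
  rw [← Nat.support_factorization, factorization_encode,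
    Finsupp.mapDomain_support_of_injective ratPrime_injective]
  constructor
  · intro h j hj
    exact h (ratPrime j) (Finset.mem_image_of_mem _ hj)
  · intro h p hp
    obtain ⟨j, hj, rfl⟩ := Finset.mem_image.mp hp
    exact h hj

/-- **The Möbius function depends only on the exponent pattern**: `μ(∏ q_{f(j)}^{k_j}) = μ(∏ q_j^{k_j})` for
injective `f` (both are `(−1)^{#supp k}` if all `k_j ≤ 1`, else `0`). [folklore] -/
theorem moebius_encode_mapDomain {f : ℕ → ℕ} (hf : Function.Injective f) (k : ℕ →₀ ℕ) :
    μ (encode (Finsupp.mapDomain f k)) = μ (encode k) := by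
  classical
  have hsq : ∀ φ : ℕ → ℕ, Function.Injective φ →
      (Squarefree (encode (Finsupp.mapDomain φ k)) ↔ ∀ j, k j ≤ 1) := by
    intro φ hφ
    have hinj : Function.Injective (ratPrime ∘ φ) := ratPrime_injective.comp hφ
    rw [Nat.squarefree_iff_factorization_le_one (encode_ne_zero _), factorization_encode,
      ← Finsupp.mapDomain_comp]
    constructor
    · intro h j
      have := h ((ratPrime ∘ φ) j)
      rwa [Finsupp.mapDomain_apply hinj] at this
    · intro h p
      by_cases hp : p ∈ Set.range (ratPrime ∘ φ)
      · obtain ⟨j, rfl⟩ := hp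
        rw [Finsupp.mapDomain_apply hinj]; exact h j
      · rw [Finsupp.mapDomain_notin_range _ _ hp]; exact zero_le_one
  have hcard : ∀ φ : ℕ → ℕ, Function.Injective φ →
      (encode (Finsupp.mapDomain φ k)).primeFactors.card = k.support.card := by
    intro φ hφ
    have hinj : Function.Injective (ratPrime ∘ φ) := ratPrime_injective.comp hφ
    rw [← Nat.support_factorization, factorization_encode, ← Finsupp.mapDomain_comp,
      Finsupp.mapDomain_support_of_injective hinj, Finset.card_image_of_injective _ hinj]
  have key : ∀ φ : ℕ → ℕ, Function.Injective φ →
      μ (encode (Finsupp.mapDomain φ k)) = if ∀ j, k j ≤ 1 then (-1) ^ k.support.card else 0 := by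
    intro φ hφ
    split_ifs with h
    · have hsqf := (hsq φ hφ).mpr h
      have hω := (cardDistinctFactors_eq_cardFactors_iff_squarefree (encode_ne_zero _)).mpr hsqf
      rw [moebius_apply_of_squarefree hsqf, ← hω, cardDistinctFactors_apply, ← List.card_toFinset,
        Nat.toFinset_factors, hcard φ hφ]
    · exact moebius_eq_zero_of_not_squarefree (mt (hsq φ hφ).mp h)
  rw [key f hf]
  conv_rhs => rw [← Finsupp.mapDomain_id (v := k)]
  rw [key id Function.injective_id]

/-- **The integers of `𝒫_𝒮` ↔ the `S`-smooth positive integers**: for `x ≥ 0` and any `G`,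
`Σ_{k : n_k ≤ x} G(n_k) = Σ_{n ≤ x} 1_{𝒩_𝒮}(n) G(n)`, where `n_k = ∏ q_{d_j}^{k_j}` is the generalized integer of
`𝒫_𝒮 = ratPrimes.restrict (delIdx S)` with exponent vector `k` (BDR: "`𝒩_𝒮` the integers generated by `𝒫_𝒮`").
[cite: BrouckeDebruyneRevesz2023, §5 p. 16] -/
theorem sum_intFinset_restrict_eq (hD : (delIdx S).Infinite) (G : ℕ → ℝ) {x : ℝ} (hx : 0 ≤ x) :
    ∑ k ∈ Hilberdink.intFinset (ratPrimes.restrict hD) x,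
        G (encode (Finsupp.mapDomain (Nat.nth fun i ↦ i ∈ delIdx S) k)) =
      ∑ n ∈ Finset.Icc 0 ⌊x⌋₊, smoothInd S n * G n := by
  classical
  have hrhs : ∑ n ∈ Finset.Icc 0 ⌊x⌋₊, smoothInd S n * G n =
      ∑ n ∈ (Finset.Icc 0 ⌊x⌋₊).filter (fun n ↦ n ≠ 0 ∧ IsSmooth S n), G n := by
    rw [Finset.sum_filter]
    refine Finset.sum_congr rfl fun n _ ↦ ?_
    unfold smoothInd
    split_ifs <;> simp
  rw [hrhs]
  refine Finset.sum_bij (fun k _ ↦ encode (Finsupp.mapDomain (Nat.nth fun i ↦ i ∈ delIdx S) k)) ?_ ?_ ?_ ?_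
  · intro k hk
    have hk' := (Hilberdink.mem_intFinset _).mp hk
    rw [BeurlingPrimes.genInt_restrict, genInt_ratPrimes] at hk'
    rw [Finset.mem_filter, Finset.mem_Icc]
    refine ⟨⟨Nat.zero_le _, ?_⟩, encode_ne_zero _, ?_⟩
    · rw [Nat.le_floor_iff hx]; exact hk'
    · rw [isSmooth_encode_iff]; exact ((restrictExpEquiv hD) k).2
  · intro a _ b _ hab
    exact Finsupp.mapDomain_injective (Nat.nth_injective (infinite_setOf_mem hD)) (encode_injective hab)
  · intro n hn
    rw [Finset.mem_filter, Finset.mem_Icc] at hn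
    obtain ⟨⟨-, hnx⟩, hn0, hsm⟩ := hn
    obtain ⟨k', hk'⟩ := exists_encode_eq hn0
    have hsupp : (k'.support : Set ℕ) ⊆ delIdx S := by rw [← isSmooth_encode_iff, hk']; exact hsm
    have h1 : Finsupp.mapDomain (Nat.nth fun i ↦ i ∈ delIdx S) ((restrictExpEquiv hD).symm ⟨k', hsupp⟩) = k' :=
      congrArg Subtype.val ((restrictExpEquiv hD).apply_symm_apply ⟨k', hsupp⟩)
    refine ⟨(restrictExpEquiv hD).symm ⟨k', hsupp⟩, ?_, ?_⟩
    · rw [Hilberdink.mem_intFinset, BeurlingPrimes.genInt_restrict, genInt_ratPrimes, h1, hk']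
      calc (n : ℝ) ≤ ⌊x⌋₊ := by exact_mod_cast hnx
        _ ≤ x := Nat.floor_le hx
    · show encode (Finsupp.mapDomain _ ((restrictExpEquiv hD).symm ⟨k', hsupp⟩)) = n
      rw [h1, hk']
  · intro k _
    rfl

/-- **`wCount 𝒫_𝒮 1 x = N_𝒮(x) = Σ_{n ≤ x} 1_{𝒩_𝒮}(n)`** (`x ≥ 0`). [cite: BrouckeDebruyneRevesz2023, §5 p. 16] -/
theorem wCount_restrict_one (hD : (delIdx S).Infinite) {x : ℝ} (hx : 0 ≤ x) :
    wCount (ratPrimes.restrict hD) (fun _ ↦ 1) x = partialSum (smoothInd S) x := by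
  have h := sum_intFinset_restrict_eq hD (fun _ ↦ (1 : ℝ)) hx
  simp only [mul_one] at h
  exact h

/-- `1_{𝒩_𝒮}(n)(1 + μ(n)) = μ_𝒮(n) + 1_{𝒩_𝒮}(n)`. [cite: BrouckeDebruyneRevesz2023, §5 p. 16] -/
theorem smoothInd_mul_one_add_moebius (n : ℕ) : smoothInd S n * (1 + (μ n : ℝ)) = moebPlusInd S n := by
  unfold moebPlusInd moebS smoothInd
  rcases eq_or_ne n 0 with rfl | hn
  · simp
  · by_cases hs : IsSmooth S n
    · rw [if_pos ⟨hn, hs⟩, if_pos hs]; ring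
    · rw [if_neg (fun h ↦ hs h.2), if_neg hs]; ring

/-- **`wCount 𝒫_𝒮 (1 + μ_𝒫) x = N_𝒮(x) + M_𝒮(x) = Σ_{n ≤ x} (μ_𝒮 + 1_{𝒩_𝒮})(n)`** (`x ≥ 0`).
[cite: BrouckeDebruyneRevesz2023, §5 p. 16] -/
theorem wCount_restrict_one_add_moebW (hD : (delIdx S).Infinite) {x : ℝ} (hx : 0 ≤ x) :
    wCount (ratPrimes.restrict hD) (fun k ↦ 1 + (ratPrimes.restrict hD).moebW k) x =
      partialSum (moebPlusInd S) x := by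
  have h := sum_intFinset_restrict_eq hD (fun n ↦ 1 + (μ n : ℝ)) hx
  simp only [smoothInd_mul_one_add_moebius] at h
  show ∑ k ∈ Hilberdink.intFinset (ratPrimes.restrict hD) x, (1 + (ratPrimes.restrict hD).moebW k) =
    ∑ n ∈ Finset.Icc 0 ⌊x⌋₊, moebPlusInd S n
  rw [← h]
  refine Finset.sum_congr rfl fun k _ ↦ ?_
  rw [BeurlingPrimes.moebW, moebius_encode_mapDomain (Nat.nth_injective (infinite_setOf_mem hD))]

end dictionary

/-! ### The Dirichlet series of the two weights -/

section series

variable (P : BeurlingPrimes)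

/-- `wSeries 𝒫 1 = ζ_𝒫`. [folklore] -/
theorem wSeries_one (s : ℂ) : wSeries P (fun _ ↦ 1) s = P.zeta s := by
  unfold wSeries BeurlingPrimes.zeta
  exact tsum_congr fun k ↦ by push_cast; ring

/-- `wSeries 𝒫 (1 + μ_𝒫) s = ζ_𝒫(s) + ζ_𝒫(s)⁻¹` (`Re s > 0`, `Σ_j λ_j^{−σ} < ∞`). [cite: BrouckeDebruyneRevesz2023, §5 p. 16] -/
theorem wSeries_one_add_moebW {s : ℂ} (hs : 0 < s.re) (hsum : Summable fun j ↦ P.prime j ^ (-s.re)) :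
    wSeries P (fun k ↦ 1 + P.moebW k) s = P.zeta s + (P.zeta s)⁻¹ :=
  (P.hasSum_one_add_moebW_mul_cpow hs hsum).tsum_eq

/-- `0 ≤ wCount 𝒫 w x ≤ W · #{k : n_k ≤ 2}` for `x ≤ 2` when `|w| ≤ W`. [folklore] -/
theorem abs_wCount_le {w : (ℕ →₀ ℕ) → ℝ} {W : ℝ} (hwW : ∀ k, |w k| ≤ W) {x : ℝ} (hx : x ≤ 2) :
    |wCount P w x| ≤ W * (Hilberdink.intFinset P 2).card := by
  have hW0 : 0 ≤ W := (abs_nonneg _).trans (hwW 0)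
  unfold wCount
  calc |∑ k ∈ Hilberdink.intFinset P x, w k| ≤ ∑ k ∈ Hilberdink.intFinset P x, |w k| :=
        Finset.abs_sum_le_sum_abs _ _
    _ ≤ ∑ k ∈ Hilberdink.intFinset P x, W := Finset.sum_le_sum fun k _ ↦ hwW k
    _ = W * (Hilberdink.intFinset P x).card := by rw [Finset.sum_const, nsmul_eq_mul, mul_comm]
    _ ≤ W * (Hilberdink.intFinset P 2).card := by
        gcongr
        exact Hilberdink.intFinset_mono P hx

end series

/-! ### The regular part of `ζ(s+1−α)E(s)` at `α` and the continuation of `1/ζ_𝒮` -/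

section parts

variable {α : ℝ} {E : ℂ → ℂ}

/-- The regular part of `ζ(s+1−α)E(s)` at `s = α`: `ζ₀(s+1−α)E(s) + (E(s) − E(α))/(s−α)`.
[cite: BrouckeDebruyneRevesz2023, §5 p. 16; proof of Theorem 3.2, (3.7)] -/
def regPart (α : ℝ) (E : ℂ → ℂ) (s : ℂ) : ℂ := riemannZeta₀ (s + 1 - α) * E s + dslope E α s

/-- The continuation of `1/ζ_𝒮(s) = (ζ(s+1−α)E(s))⁻¹`: `(s−α)/ζ₁(s+1−α) · E(s)⁻¹`.
[cite: BrouckeDebruyneRevesz2023, §5 p. 16] -/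
def invPart (α : ℝ) (E : ℂ → ℂ) (s : ℂ) : ℂ := (s - α) / riemannZeta₁ (s + 1 - α) * (E s)⁻¹

/-- **`ζ(s+1−α)E(s) = E(α)/(s−α) + regPart(s)`** for `s ≠ α`. [cite: BrouckeDebruyneRevesz2023, proof of Theorem 3.2, (3.7)] -/
theorem mul_eq_polePart_add_regPart {s : ℂ} (hs : s ≠ α) :
    riemannZeta (s + 1 - α) * E s = polePart {α} (fun _ ↦ E α) s + regPart α E s := by
  have hw : s + 1 - (α : ℂ) ≠ 1 := by
    intro h; apply hs; linear_combination h
  have hsub : s - α ≠ 0 := sub_ne_zero.mpr hs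
  rw [polePart, Finset.sum_singleton, regPart, riemannZeta_eq_inv_sub_add hw, dslope_of_ne _ hs,
    slope_def_field, show s + 1 - (α : ℂ) - 1 = s - α by ring]
  field_simp
  ring

/-- **`(ζ(s+1−α)E(s))⁻¹ = invPart(s)`** for `s ≠ α`. [cite: BrouckeDebruyneRevesz2023, §5 p. 16] -/
theorem inv_mul_eq_invPart {s : ℂ} (hs : s ≠ α) :
    (riemannZeta (s + 1 - α) * E s)⁻¹ = invPart α E s := by
  have hw : s + 1 - (α : ℂ) ≠ 1 := by
    intro h; apply hs; linear_combination h
  rw [mul_inv, LittlewoodRH.inv_riemannZeta_eq _ hw, invPart, show s + 1 - (α : ℂ) - 1 = s - α by ring]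

/-- `regPart` is holomorphic where `E` is (on an open half-plane containing `α`). [cite: BrouckeDebruyneRevesz2023, §5 p. 16] -/
theorem differentiableOn_regPart {σ₀ : ℝ} (hσ₀ : σ₀ < α) (hE : DifferentiableOn ℂ E {s : ℂ | σ₀ < s.re}) :
    DifferentiableOn ℂ (regPart α E) {s : ℂ | σ₀ < s.re} := by
  have hU : IsOpen {s : ℂ | σ₀ < s.re} := isOpen_lt continuous_const Complex.continuous_re
  have hαU : {s : ℂ | σ₀ < s.re} ∈ 𝓝 (α : ℂ) := hU.mem_nhds (by simpa using hσ₀)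
  have h1 : DifferentiableOn ℂ (fun s : ℂ ↦ riemannZeta₀ (s + 1 - α)) {s : ℂ | σ₀ < s.re} := by
    have : (fun s : ℂ ↦ riemannZeta₀ (s + 1 - α)) = riemannZeta₀ ∘ fun s ↦ s + 1 - α := rfl
    rw [this]
    exact differentiable_riemannZeta₀.comp_differentiableOn (by fun_prop)
  unfold regPart
  exact (h1.mul hE).add ((Complex.differentiableOn_dslope hαU).mpr hE)

/-- **Under RH, `invPart` is holomorphic on `Re s > σ₀`** whenever `σ₀ ≥ α − 1/2` and `E` is holomorphic and
zero-free there (`ζ₁(s+1−α) ≠ 0` for `Re(s+1−α) > 1/2`). [cite: BrouckeDebruyneRevesz2023, §5 p. 16] -/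
theorem differentiableOn_invPart (hRH : RiemannHypothesis) {σ₀ : ℝ} (hσ₀ : α - 1 / 2 ≤ σ₀)
    (hE : DifferentiableOn ℂ E {s : ℂ | σ₀ < s.re}) (hE0 : ∀ s : ℂ, σ₀ < s.re → E s ≠ 0) :
    DifferentiableOn ℂ (invPart α E) {s : ℂ | σ₀ < s.re} := by
  have h1 : DifferentiableOn ℂ (fun s : ℂ ↦ (s - α) / riemannZeta₁ (s + 1 - α)) {s : ℂ | σ₀ < s.re} := by
    refine DifferentiableOn.div (by fun_prop) (by fun_prop) fun s hs ↦ ?_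
    have hs' : σ₀ < s.re := hs
    exact LittlewoodRH.riemannZeta₁_ne_zero_of_RH hRH
      (by simp only [sub_re, add_re, one_re, ofReal_re]; linarith)
  unfold invPart
  exact h1.mul (hE.inv fun s hs ↦ hE0 s hs)

/-- `(1+|t|)^a (1+|t|)^b = (1+|t|)^{a+b}` and monotonicity helpers. [folklore] -/
theorem one_add_abs_rpow_mono {t a b : ℝ} (hab : a ≤ b) : (1 + |t|) ^ a ≤ (1 + |t|) ^ b :=
  Real.rpow_le_rpow_of_exponent_le (by linarith [abs_nonneg t]) hab

/-- **Strip bound for the regular part**: under RH, if `‖E(s)‖ ≤ B_E(1+|t|)^{η/2}` on `σ₁ ≤ Re s ≤ 3`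
(`α/2 < σ₁`, `1/2 < α < 1`) and `E` is holomorphic on `Re s > σ₀` (`σ₀ < σ₁`, `σ₀ < α`), then
`‖regPart(u+it)‖ ≤ B₀(1+|t|)^η` for `σ₁ ≤ u ≤ 2`, all `t` (`|t| ≥ 1`: `ζ₀ = ζ − 1/(w−1)` and Littlewood's
`ζ(w) ≪ |t|^{η/2}`; `|t| ≤ 1`: compactness). [cite: BrouckeDebruyneRevesz2023, proof of Theorem 3.2, (3.8); §5 p. 16] -/
theorem norm_regPart_le (hRH : RiemannHypothesis) (hα : 1 / 2 < α) (hα1 : α < 1)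
    {σ₀ σ₁ : ℝ} (hσ₀₁ : σ₀ < σ₁) (hσ₀α : σ₀ < α) (hσ₁ : α / 2 < σ₁)
    (hE : DifferentiableOn ℂ E {s : ℂ | σ₀ < s.re}) {η B : ℝ} (hη : 0 < η)
    (hEB : ∀ s : ℂ, σ₁ ≤ s.re → s.re ≤ 3 → ‖E s‖ ≤ B * (1 + |s.im|) ^ (η / 2)) :
    ∃ B₀ : ℝ, 0 ≤ B₀ ∧ ∀ u : ℝ, σ₁ ≤ u → u ≤ 2 → ∀ t : ℝ, ‖regPart α E ((u : ℂ) + t * I)‖ ≤ B₀ * (1 + |t|) ^ η := by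
  -- Littlewood: `‖ζ(w)‖ ≤ C |Im w|^{η/2}` for `Re w ≥ σ₁ + 1 − α > 1/2`, `|Im w| ≥ 1`
  obtain ⟨Cζ, hCζ, hζ⟩ := LittlewoodRH.norm_riemannZeta_le_of_RH hRH (show 1 / 2 < σ₁ + 1 - α by linarith)
    (half_pos hη)
  -- compact part
  have hK : IsCompact (Icc σ₁ 2 ×ℂ Icc (-1 : ℝ) 1) := isCompact_Icc.reProdIm isCompact_Icc
  have hKU : Icc σ₁ 2 ×ℂ Icc (-1 : ℝ) 1 ⊆ {s : ℂ | σ₀ < s.re} := fun s hs ↦ lt_of_lt_of_le hσ₀₁ hs.1.1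
  obtain ⟨M, hM⟩ := hK.exists_bound_of_continuousOn
    (((differentiableOn_regPart hσ₀α hE).continuousOn).mono hKU)
  set B' : ℝ := max B 0 with hB'def
  have hB0 : 0 ≤ B' := le_max_right _ _
  set e₀ : ℝ := ‖E α‖ with he₀
  set B₀ : ℝ := max M 0 + ((Cζ + 1) * B' + B' + e₀) with hB₀def
  have hM0 : M ≤ max M 0 := le_max_left _ _
  refine ⟨B₀, by positivity, fun u hu1 hu2 t ↦ ?_⟩
  set s : ℂ := (u : ℂ) + t * I with hsdef
  have hsre : s.re = u := by simp [hsdef]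
  have hsim : s.im = t := by simp [hsdef]
  have hpow1 : 1 ≤ (1 + |t|) ^ η := Real.one_le_rpow (by linarith [abs_nonneg t]) hη.le
  have hpowh : 1 ≤ (1 + |t|) ^ (η / 2) := Real.one_le_rpow (by linarith [abs_nonneg t]) (half_pos hη).le
  have hpow_le : (1 + |t|) ^ (η / 2) ≤ (1 + |t|) ^ η := one_add_abs_rpow_mono (by linarith)
  have hpow_mul : (1 + |t|) ^ (η / 2) * (1 + |t|) ^ (η / 2) = (1 + |t|) ^ η := by
    rw [← Real.rpow_add (by linarith [abs_nonneg t])]; ring_nf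
  rcases lt_or_ge |t| 1 with ht | ht
  · -- compact part
    have hmem : s ∈ Icc σ₁ 2 ×ℂ Icc (-1 : ℝ) 1 := by
      refine ⟨⟨by rw [hsre]; exact hu1, by rw [hsre]; exact hu2⟩, ?_, ?_⟩
      · rw [hsim]; linarith [neg_abs_le t]
      · rw [hsim]; linarith [le_abs_self t]
    calc ‖regPart α E s‖ ≤ M := hM s hmem
      _ ≤ max M 0 * (1 + |t|) ^ η := hM0.trans (le_mul_of_one_le_right (le_max_right _ _) hpow1)
      _ ≤ B₀ * (1 + |t|) ^ η := by
          gcongr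
          rw [hB₀def]
          have : 0 ≤ (Cζ + 1) * B' + B' + e₀ := by positivity
          linarith
  · -- `|t| ≥ 1`
    have hsα : s ≠ α := by
      intro h
      have := congrArg Complex.im h
      rw [hsim, ofReal_im] at this
      rw [this, abs_zero] at ht
      linarith
    have hw : s + 1 - (α : ℂ) ≠ 1 := by
      intro h; apply hsα; linear_combination h
    have hEs : ‖E s‖ ≤ B' * (1 + |t|) ^ (η / 2) := by
      have h := hEB s (by rw [hsre]; exact hu1) (by rw [hsre]; linarith)
      rw [hsim] at h
      exact h.trans (mul_le_mul_of_nonneg_right (le_max_left _ _) (by positivity))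
    -- `ζ₀(w) = ζ(w) − (w−1)⁻¹`
    have hζ₀ : ‖riemannZeta₀ (s + 1 - α)‖ ≤ (Cζ + 1) * (1 + |t|) ^ (η / 2) := by
      have h1 : riemannZeta₀ (s + 1 - α) = riemannZeta (s + 1 - α) - (s + 1 - α - 1)⁻¹ := by
        rw [riemannZeta_eq_inv_sub_add hw]; ring
      have hwim : (s + 1 - (α : ℂ)).im = t := by simp [hsdef]
      have hζb := hζ (s + 1 - α) (by simp only [sub_re, add_re, one_re, ofReal_re, hsre]; linarith)
        (by rw [hwim]; exact ht)
      rw [hwim] at hζb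
      have hinv : ‖(s + 1 - (α : ℂ) - 1)⁻¹‖ ≤ 1 := by
        rw [norm_inv, show s + 1 - (α : ℂ) - 1 = s - α by ring]
        have him : |t| ≤ ‖s - (α : ℂ)‖ := by
          have := abs_im_le_norm (s - (α : ℂ))
          rwa [sub_im, ofReal_im, sub_zero, hsim] at this
        exact inv_le_one_of_one_le₀ (ht.trans him)
      have habs : |t| ^ (η / 2) ≤ (1 + |t|) ^ (η / 2) :=
        Real.rpow_le_rpow (abs_nonneg t) (by linarith) (half_pos hη).le
      calc ‖riemannZeta₀ (s + 1 - α)‖ ≤ ‖riemannZeta (s + 1 - α)‖ + ‖(s + 1 - (α : ℂ) - 1)⁻¹‖ := by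
            rw [h1]; exact norm_sub_le _ _
        _ ≤ Cζ * |t| ^ (η / 2) + 1 := add_le_add hζb hinv
        _ ≤ Cζ * (1 + |t|) ^ (η / 2) + 1 * (1 + |t|) ^ (η / 2) :=
            add_le_add (mul_le_mul_of_nonneg_left habs hCζ.le) (by rw [one_mul]; exact hpowh)
        _ = (Cζ + 1) * (1 + |t|) ^ (η / 2) := by ring
    -- `dslope E α s = (E s − E α)/(s − α)`, `‖s − α‖ ≥ |t| ≥ 1`
    have hds : ‖dslope E α s‖ ≤ B' * (1 + |t|) ^ (η / 2) + e₀ := by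
      rw [dslope_of_ne _ hsα, slope_def_field, norm_div]
      have him : 1 ≤ ‖s - (α : ℂ)‖ := by
        have := abs_im_le_norm (s - (α : ℂ))
        rw [sub_im, ofReal_im, sub_zero, hsim] at this
        exact ht.trans this
      calc ‖E s - E α‖ / ‖s - (α : ℂ)‖ ≤ ‖E s - E α‖ := div_le_self (norm_nonneg _) him
        _ ≤ ‖E s‖ + ‖E α‖ := norm_sub_le _ _
        _ ≤ B' * (1 + |t|) ^ (η / 2) + e₀ := add_le_add hEs le_rfl
    calc ‖regPart α E s‖ ≤ ‖riemannZeta₀ (s + 1 - α) * E s‖ + ‖dslope E α s‖ := norm_add_le _ _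
      _ ≤ (Cζ + 1) * (1 + |t|) ^ (η / 2) * (B' * (1 + |t|) ^ (η / 2)) + (B' * (1 + |t|) ^ (η / 2) + e₀) := by
          rw [norm_mul]
          exact add_le_add (mul_le_mul hζ₀ hEs (norm_nonneg _) (by positivity)) hds
      _ = (Cζ + 1) * B' * ((1 + |t|) ^ (η / 2) * (1 + |t|) ^ (η / 2)) + B' * (1 + |t|) ^ (η / 2) + e₀ := by ring
      _ ≤ (Cζ + 1) * B' * (1 + |t|) ^ η + B' * (1 + |t|) ^ η + e₀ * (1 + |t|) ^ η := by
          rw [hpow_mul]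
          gcongr
          exact le_mul_of_one_le_right (norm_nonneg _) hpow1
      _ = ((Cζ + 1) * B' + B' + e₀) * (1 + |t|) ^ η := by ring
      _ ≤ B₀ * (1 + |t|) ^ η := by
          gcongr
          rw [hB₀def]
          linarith [le_max_right M 0]

/-- **Strip bound for `invPart`**: under RH, `‖invPart(s)‖ ≤ C(1+|t|)^{η/2} · B(1+|t|)^{η/2}` for
`σ₁ ≤ Re s ≤ 3` (`σ₁ > α − 1/2`), given `‖E(s)⁻¹‖ ≤ B(1+|t|)^{η/2}` there (Littlewood's `1/ζ(w) ≪ (1+|t|)^ε`, pole-free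
form). BDR: "`1/ζ_𝒮(s) ≪_ε |t|^ε`". [cite: BrouckeDebruyneRevesz2023, §5 p. 16] -/
theorem norm_invPart_le (hRH : RiemannHypothesis) {σ₁ : ℝ} (hσ₁ : α - 1 / 2 < σ₁) {η B : ℝ} (hη : 0 < η)
    (hEB : ∀ s : ℂ, σ₁ ≤ s.re → s.re ≤ 3 → ‖(E s)⁻¹‖ ≤ B * (1 + |s.im|) ^ (η / 2)) :
    ∃ B₁ : ℝ, 0 ≤ B₁ ∧ ∀ s : ℂ, σ₁ ≤ s.re → s.re ≤ 3 → ‖invPart α E s‖ ≤ B₁ * (1 + |s.im|) ^ η := by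
  obtain ⟨C, hC, hb⟩ := LittlewoodRH.norm_sub_one_div_riemannZeta₁_le_of_RH hRH
    (show 1 / 2 < σ₁ + 1 - α by linarith) (half_pos hη)
  refine ⟨C * max B 0, by positivity, fun s hs1 hs3 ↦ ?_⟩
  have hw := hb (s + 1 - α) (by simp only [sub_re, add_re, one_re, ofReal_re]; linarith)
  have hwim : (s + 1 - (α : ℂ)).im = s.im := by simp
  rw [hwim, show s + 1 - (α : ℂ) - 1 = s - α by ring] at hw
  have hpos : 0 ≤ (1 + |s.im|) ^ (η / 2) := Real.rpow_nonneg (by linarith [abs_nonneg s.im]) _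
  have hEs : ‖(E s)⁻¹‖ ≤ max B 0 * (1 + |s.im|) ^ (η / 2) :=
    (hEB s hs1 hs3).trans (mul_le_mul_of_nonneg_right (le_max_left _ _) hpos)
  have hpow_mul : (1 + |s.im|) ^ (η / 2) * (1 + |s.im|) ^ (η / 2) = (1 + |s.im|) ^ η := by
    rw [← Real.rpow_add (by linarith [abs_nonneg s.im])]; ring_nf
  rw [invPart, norm_mul]
  calc ‖(s - α) / riemannZeta₁ (s + 1 - α)‖ * ‖(E s)⁻¹‖
      ≤ C * (1 + |s.im|) ^ (η / 2) * (max B 0 * (1 + |s.im|) ^ (η / 2)) :=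
        mul_le_mul hw hEs (norm_nonneg _) (by positivity)
    _ = C * max B 0 * (1 + |s.im|) ^ η := by rw [← hpow_mul]; ring

end parts

/-! ### From `x ≥ 2` to `u ≥ 1` -/

/-- Extending a bound `|f(x) − m x^α| ≤ C x^a` (`x ≥ 2`) to `u ≥ 1` with a larger exponent `b ≥ a`, `b ≥ 0`,
given a bound `M` on `[1, 2]`. [folklore] -/
theorem bound_one_of_bound_two {f : ℝ → ℝ} {m α a b M : ℝ} (hab : a ≤ b) (hb : 0 ≤ b)
    (hM : ∀ u : ℝ, 1 ≤ u → u ≤ 2 → |f u - m * u ^ α| ≤ M)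
    (h : ∃ C : ℝ, ∀ x : ℝ, 2 ≤ x → |f x - m * x ^ α| ≤ C * x ^ a) :
    ∃ C : ℝ, ∀ u : ℝ, 1 ≤ u → |f u - m * u ^ α| ≤ C * u ^ b := by
  obtain ⟨C, hC⟩ := h
  refine ⟨max (max C 0) M, fun u hu ↦ ?_⟩
  have hub : 1 ≤ u ^ b := Real.one_le_rpow hu hb
  rcases le_or_gt 2 u with h2 | h2
  · have hua : 0 ≤ u ^ a := Real.rpow_nonneg (by linarith) _
    calc |f u - m * u ^ α| ≤ C * u ^ a := hC u h2
      _ ≤ max C 0 * u ^ a := mul_le_mul_of_nonneg_right (le_max_left _ _) hua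
      _ ≤ max C 0 * u ^ b :=
          mul_le_mul_of_nonneg_left (Real.rpow_le_rpow_of_exponent_le hu hab) (le_max_right _ _)
      _ ≤ max (max C 0) M * u ^ b := mul_le_mul_of_nonneg_right (le_max_left _ _) (by linarith)
  · have hM0 : M ≤ max (max C 0) M := le_max_right _ _
    have hMM : 0 ≤ max (max C 0) M := le_trans (le_max_right _ _) (le_max_left _ _)
    calc |f u - m * u ^ α| ≤ M := hM u hu h2.le
      _ ≤ max (max C 0) M * 1 := by linarith
      _ ≤ max (max C 0) M * u ^ b := by gcongr

/-! ### The application of Perron's formula -/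

section application

variable {S : Set ℕ} {α : ℝ} {E : ℂ → ℂ}

/-- **Perron for one weight on `𝒫_𝒮`** (the common core of the two applications): if `0 ≤ w ≤ W`,
`wSeries 𝒫_𝒮 w = F` on `Re s = 2` where `F(s) = E(α)/(s−α) + H(s)` off `α` with `H` holomorphic on
`Re s > α/2 + ε/4` and `‖H(u+it)‖ ≤ B₀(1+|t|)^{ε/2}` on `α/2 + ε/2 ≤ u ≤ 2`, then
`|wCount 𝒫_𝒮 w x − (Re E(α)/α) x^α| ≤ C x^{α/2+ε}` for `x ≥ 2`. [cite: BrouckeDebruyneRevesz2023, §5 p. 16; proof of Theorem 3.2] -/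
theorem wCount_restrict_asymptotic (hD : (delIdx S).Infinite) (hα0 : 0 < α) (hα1 : α < 1)
    (hsum2 : Summable fun j ↦ (ratPrimes.restrict hD).prime j ^ (-(2 : ℝ)))
    {w : (ℕ →₀ ℕ) → ℝ} {W : ℝ} (hw0 : ∀ k, 0 ≤ w k) (hwW : ∀ k, |w k| ≤ W)
    {ε : ℝ} (hε : 0 < ε) (hεα : ε < α)
    {H : ℂ → ℂ} (hH : DifferentiableOn ℂ H {s : ℂ | α / 2 + ε / 4 < s.re})
    (hF : ∀ t : ℝ, wSeries (ratPrimes.restrict hD) w ((2 : ℝ) + t * I) =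
      polePart {α} (fun _ ↦ E α) ((2 : ℝ) + t * I) + H ((2 : ℝ) + t * I))
    {B₀ : ℝ} (hB₀ : 0 ≤ B₀)
    (hHB : ∀ u : ℝ, α / 2 + ε / 2 ≤ u → u ≤ 2 → ∀ t : ℝ, ‖H ((u : ℂ) + t * I)‖ ≤ B₀ * (1 + |t|) ^ (ε / 2)) :
    ∃ C : ℝ, ∀ x : ℝ, 2 ≤ x →
      |wCount (ratPrimes.restrict hD) w x - (E α).re / α * x ^ α| ≤ C * x ^ (α / 2 + ε) := by
  have h := wCount_asymptotic (P := ratPrimes.restrict hD) hw0 hwW (κ := 2) (by norm_num) hsum2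
    (σ₀ := α / 2 + ε / 4) (σ₁ := α / 2 + ε / 2) (by linarith) (by linarith) (by linarith)
    {α} (fun _ ↦ E α) (fun p hp ↦ by
      rw [Finset.mem_singleton] at hp; subst hp
      exact ⟨by linarith, by linarith, hα1.le⟩)
    hH hF (η := ε / 2) (by linarith) (by linarith) hB₀ hHB
  simp only [Finset.sum_singleton] at h
  obtain ⟨C, hC⟩ := h
  refine ⟨C, fun x hx ↦ ?_⟩
  have := hC x hx
  rwa [show α / 2 + ε / 2 + ε / 2 = α / 2 + ε by ring] at this

/-- **BDR §5, the two Perron estimates for the `S`-smooth integers, under RH.** Let `1/2 < α < 1`, `S ⊆ ℙ` with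
`delIdx S` infinite and `Σ_{p∈S} p^{−u} < ∞` for `u > α`, and suppose `ζ_𝒮(s) = ζ(s+1−α)E(s)` for `Re s > 1` with
`E` holomorphic and zero-free on `Re s > α/2` and `‖E(s)^{±1}‖ ≤ B_{σ₁,η}(1+|t|)^η` on `α/2 < σ₁ ≤ Re s ≤ 3` for
every `η > 0`. Then, with `a_𝒮 := Re E(α)/α`, for every `ε > 0`:
`Σ_{n ≤ u} 1_{𝒩_𝒮}(n) = a_𝒮 u^α + O(u^{α/2+ε})` and `Σ_{n ≤ u} (μ_𝒮 + 1_{𝒩_𝒮})(n) = a_𝒮 u^α + O(u^{α/2+ε})` (`u ≥ 1`)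
— "`N_𝒮(x) = a_𝒮x^α + O_ε(x^{α/2+ε})` … the same asymptotic estimate holds for `N_𝒮(x) + M_𝒮(x)`".
[cite: BrouckeDebruyneRevesz2023, §5 p. 16] -/
theorem smooth_partialSum_asymptotics (hRH : RiemannHypothesis) (hα : 1 / 2 < α) (hα1 : α < 1)
    (hD : (delIdx S).Infinite)
    (hsum : ∀ u : ℝ, α < u → Summable fun j ↦ (ratPrimes.restrict hD).prime j ^ (-u))
    (hEd : DifferentiableOn ℂ E {s : ℂ | α / 2 < s.re})
    (hEζ : ∀ s : ℂ, 1 < s.re → (ratPrimes.restrict hD).zeta s = riemannZeta (s + 1 - α) * E s)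
    (hE0 : ∀ s : ℂ, α / 2 < s.re → E s ≠ 0)
    (hEb : ∀ σ₁ : ℝ, α / 2 < σ₁ → ∀ η : ℝ, 0 < η → ∃ B : ℝ, ∀ s : ℂ, σ₁ ≤ s.re → s.re ≤ 3 →
      ‖E s‖ ≤ B * (1 + |s.im|) ^ η ∧ ‖(E s)⁻¹‖ ≤ B * (1 + |s.im|) ^ η) :
    (∀ ε : ℝ, 0 < ε → ∃ C : ℝ, ∀ u : ℝ, 1 ≤ u →
        |partialSum (smoothInd S) u - (E α).re / α * u ^ α| ≤ C * u ^ (α / 2 + ε)) ∧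
    (∀ ε : ℝ, 0 < ε → ∃ C : ℝ, ∀ u : ℝ, 1 ≤ u →
        |partialSum (moebPlusInd S) u - (E α).re / α * u ^ α| ≤ C * u ^ (α / 2 + ε)) := by
  set P := ratPrimes.restrict hD with hP
  have hα0 : 0 < α := by linarith
  have hsum2 : Summable fun j ↦ P.prime j ^ (-(2 : ℝ)) := hsum 2 (by linarith)
  -- for a given `ε ∈ (0, α)`, the data of `wCount_restrict_asymptotic` for both weights
  have core : ∀ ε : ℝ, 0 < ε → ε < α →
      (∃ C : ℝ, ∀ x : ℝ, 2 ≤ x → |wCount P (fun _ ↦ 1) x - (E α).re / α * x ^ α| ≤ C * x ^ (α / 2 + ε)) ∧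
      (∃ C : ℝ, ∀ x : ℝ, 2 ≤ x →
        |wCount P (fun k ↦ 1 + P.moebW k) x - (E α).re / α * x ^ α| ≤ C * x ^ (α / 2 + ε)) := by
    intro ε hε hεα
    have hσ₀ : α / 2 < α / 2 + ε / 4 := by linarith
    have hσ₁ : α / 2 < α / 2 + ε / 2 := by linarith
    have hEd' : DifferentiableOn ℂ E {s : ℂ | α / 2 + ε / 4 < s.re} :=
      hEd.mono fun s hs ↦ lt_trans hσ₀ hs
    have hE0' : ∀ s : ℂ, α / 2 + ε / 4 < s.re → E s ≠ 0 := fun s hs ↦ hE0 s (lt_trans hσ₀ hs)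
    obtain ⟨B, hB⟩ := hEb (α / 2 + ε / 2) hσ₁ (ε / 2 / 2) (by linarith)
    -- regular part
    have hreg := differentiableOn_regPart (E := E) (show α / 2 + ε / 4 < α by linarith) hEd'
    obtain ⟨B₀, hB₀, hHB⟩ := norm_regPart_le (E := E) hRH hα hα1 (show α / 2 + ε / 4 < α / 2 + ε / 2 by linarith)
      (show α / 2 + ε / 4 < α by linarith) hσ₁ hEd' (half_pos hε) (fun s hs1 hs3 ↦ (hB s hs1 hs3).1)
    -- inverse part
    have hinv := differentiableOn_invPart (E := E) hRH (show α - 1 / 2 ≤ α / 2 + ε / 4 by linarith) hEd' hE0'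
    obtain ⟨B₁, hB₁, hIB⟩ := norm_invPart_le (E := E) (α := α) hRH (show α - 1 / 2 < α / 2 + ε / 2 by linarith)
      (half_pos hε) (fun s hs1 hs3 ↦ (hB s hs1 hs3).2)
    -- the series on the line `Re s = 2`
    have hline : ∀ t : ℝ, (((2 : ℝ) : ℂ) + t * I).re = 2 ∧ (((2 : ℝ) : ℂ) + t * I) ≠ α ∧
        P.zeta (((2 : ℝ) : ℂ) + t * I) = riemannZeta (((2 : ℝ) : ℂ) + t * I + 1 - α) * E (((2 : ℝ) : ℂ) + t * I) := by
      intro t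
      have hre : (((2 : ℝ) : ℂ) + t * I).re = 2 := by simp
      refine ⟨hre, fun h ↦ ?_, hEζ _ (by rw [hre]; norm_num)⟩
      have := congrArg Complex.re h
      rw [hre, ofReal_re] at this
      linarith
    constructor
    · refine wCount_restrict_asymptotic hD hα0 hα1 hsum2 (W := 1) (fun _ ↦ zero_le_one) (fun _ ↦ by norm_num)
        hε hεα hreg (fun t ↦ ?_) hB₀ hHB
      obtain ⟨-, hne, hz⟩ := hline t
      rw [wSeries_one, hz, mul_eq_polePart_add_regPart hne]
    · refine wCount_restrict_asymptotic hD hα0 hα1 hsum2 (fun k ↦ P.one_add_moebW_nonneg k)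
        (fun k ↦ P.abs_one_add_moebW_le k) hε hεα (hreg.add hinv) (fun t ↦ ?_) (add_nonneg hB₀ hB₁)
        (fun u hu1 hu2 t ↦ ?_)
      · obtain ⟨hre, hne, hz⟩ := hline t
        rw [wSeries_one_add_moebW P (by rw [hre]; norm_num) (hsum _ (by rw [hre]; linarith)), hz,
          inv_mul_eq_invPart hne, mul_eq_polePart_add_regPart hne]
        simp only [Pi.add_apply]
        ring
      · have hure : ((u : ℂ) + t * I).re = u := by simp
        have huim : ((u : ℂ) + t * I).im = t := by simp
        have h2 := hIB ((u : ℂ) + t * I) (by rw [hure]; exact hu1) (by rw [hure]; linarith)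
        rw [huim] at h2
        calc ‖(regPart α E + invPart α E) ((u : ℂ) + t * I)‖
            ≤ ‖regPart α E ((u : ℂ) + t * I)‖ + ‖invPart α E ((u : ℂ) + t * I)‖ := norm_add_le _ _
          _ ≤ B₀ * (1 + |t|) ^ (ε / 2) + B₁ * (1 + |t|) ^ (ε / 2) := add_le_add (hHB u hu1 hu2 t) h2
          _ = (B₀ + B₁) * (1 + |t|) ^ (ε / 2) := by ring
  -- the bound on `[1, 2]`
  have hM : ∀ (w : (ℕ →₀ ℕ) → ℝ) (W : ℝ), (∀ k, |w k| ≤ W) → ∀ u : ℝ, 1 ≤ u → u ≤ 2 →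
      |wCount P w u - (E α).re / α * u ^ α| ≤ W * (Hilberdink.intFinset P 2).card + |(E α).re / α| * 2 := by
    intro w W hwW u hu1 hu2
    have h1 := abs_wCount_le P hwW hu2
    have h2 : |(E α).re / α * u ^ α| ≤ |(E α).re / α| * 2 := by
      rw [abs_mul, abs_of_nonneg (Real.rpow_nonneg (by linarith) _)]
      refine mul_le_mul_of_nonneg_left ?_ (abs_nonneg _)
      calc u ^ α ≤ u ^ (1 : ℝ) := Real.rpow_le_rpow_of_exponent_le hu1 hα1.le
        _ = u := Real.rpow_one u
        _ ≤ 2 := hu2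
    calc |wCount P w u - (E α).re / α * u ^ α| ≤ |wCount P w u| + |(E α).re / α * u ^ α| := abs_sub _ _
      _ ≤ _ := add_le_add h1 h2
  -- assemble, with `ε₁ = min ε (α/2)`
  constructor
  · intro ε hε
    set ε₁ : ℝ := min ε (α / 2) with hε₁
    have hε₁0 : 0 < ε₁ := lt_min hε (by linarith)
    have hε₁α : ε₁ < α := lt_of_le_of_lt (min_le_right _ _) (by linarith)
    obtain ⟨h1, -⟩ := core ε₁ hε₁0 hε₁α
    have h := bound_one_of_bound_two (f := fun u ↦ wCount P (fun _ ↦ 1) u) (show α / 2 + ε₁ ≤ α / 2 + ε by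
      linarith [min_le_left ε (α / 2)]) (by linarith) (hM (fun _ ↦ 1) 1 (fun _ ↦ by norm_num)) h1
    obtain ⟨C, hC⟩ := h
    refine ⟨C, fun u hu ↦ ?_⟩
    rw [← wCount_restrict_one hD (by linarith)]
    exact hC u hu
  · intro ε hε
    set ε₁ : ℝ := min ε (α / 2) with hε₁
    have hε₁0 : 0 < ε₁ := lt_min hε (by linarith)
    have hε₁α : ε₁ < α := lt_of_le_of_lt (min_le_right _ _) (by linarith)
    obtain ⟨-, h2⟩ := core ε₁ hε₁0 hε₁α
    have h := bound_one_of_bound_two (f := fun u ↦ wCount P (fun k ↦ 1 + P.moebW k) u)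
      (show α / 2 + ε₁ ≤ α / 2 + ε by linarith [min_le_left ε (α / 2)]) (by linarith)
      (hM (fun k ↦ 1 + P.moebW k) 2 (fun k ↦ P.abs_one_add_moebW_le k)) h2
    obtain ⟨C, hC⟩ := h
    refine ⟨C, fun u hu ↦ ?_⟩
    rw [← wCount_restrict_one_add_moebW hD (by linarith)]
    exact hC u hu

end application

end Literature.NumberTheory.BeurlingPrimes
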